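import Literature.AlgebraicGeometry.ShimuraVarieties.UnitaryBallClassLiftTranslate
import Literature.AlgebraicGeometry.ShimuraVarieties.UnitaryBallHolomorphicTranslate
import Literature.Geometry.ComplexHyperbolic.UnitBallLineField
import HarnessLib

/-!
# The Hecke wedge: two non-zero holomorphic one-forms on a compact ball quotient have a non-zero wedge after a
# Hecke translation

Topic `AlgebraicGeometry/ShimuraVarieties`. Reproduction (kernel): theorems only, no records, no new hypotheses.

**On the ball** (namespace `BallForms`).  Let `Δ ≤ U(2,1)` be a DENSE subgroup and `F, G : 𝔹² → ℂ²` non-zero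
holomorphic sections (coefficients of `(1,0)`-forms `Σ Fᵢ dzᵢ`).  The `ℂ`-spans of the translates
`γ^* F : z ↦ J(γ, z)ᵀ F(γ z)`, `γ ∈ Δ` (Borel §5.13–5.14), are non-zero `Δ`-stable spaces of continuous cotangent
fields for the transpose-inverse Jacobian cocycle `BallModel.A` (`translate_mem_span_translates`,
`stableUnder_span_translates`), so the tree's line-field theorem `BallModel.exists_wedge_ne_zero'` (dense
subgroup + `SU(2)`-isotropy at the origin) gives translates `γ^*F`, `δ^*G` with a non-zero wedge somewhere; moving
`δ` to the other side (`J(γδ, z) = J(γ, δz) J(δ, z)`, `det J ≠ 0`):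

* **`BallForms.exists_translate_wedge_ne_zero`** — `∃ γ ∈ Δ, ∃ z, (γ^* F)(z) ∧ G(z) ≠ 0`.

**On a compact ball quotient surface** `X(ℂ) = Γ\𝔹²` (`UnitaryBallUniformisationDatum 2 X`, frame `𝔣`; namespace
`UnitaryBallUniformisationDatum`).  For two NON-ZERO classes `a, a' ∈ F¹H¹(X) = H^{1,0}` their holomorphic lifts
`lift a`, `lift a'` to `𝔹²` (`classLift`, `UnitaryBallHolomorphicLift`) are non-zero holomorphic sections
(`classLift_ne_zero`, Voisin I Cor. 7.6), so for a dense `Δ` there is `ĝ ∈ Δ` with `(ĝ^* lift a) ∧ lift a' ≢ 0`.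
Now let `X'` be ANY ball quotient over the same hermitian space carrying a Hecke translation `T : X' ⟶ X` over
`v ↦ g v` (`g ∈ U(H^{τ₁})` with `T⁻¹ g T = ĝ`; `UnitaryBallHeckeTranslation`) and a level covering `π : X' ⟶ X`
over `v ↦ v` (`UnitaryBallLevelCovering`) — e.g. the Hecke level `Γ ∩ γ⁻¹Γγ` of a rational isometry `γ` with
`γ^{τ₁} = g`.  The lifts of `T^* a`, `π^* a'` are `ĝ^*(lift a)` (`classLift_pull_mulVec`) and `lift a'`
(`classLift_pull`), and a vanishing cup product `T^*a ∪ π^*a' = 0` would force their wedge to vanish identically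
(`wedge_classLift_eq_zero`: de Rham and `Θ` are multiplicative, and a holomorphic `2`-form on a compact surface
with zero class is zero, Voisin I Prop. 7.5).  Hence:

* **`UnitaryBallUniformisationDatum.exists_mem_forall_cup_pull_ne_zero`** — there is `ĝ ∈ Δ` such that for EVERY
  such `(X', T, π)` the cup product `T^* a ∪ π^* a' ∈ ℂ ⊗_ℚ H²(X'(ℂ); ℚ)` is NON-ZERO.

With `Δ` the image of the rational isometries `U(V)(F)` in `U(2,1)` (dense by real approximation, the tree's
`RealApproximation.dense_range_toFrameUnitary`) this is the HOLOMORPHIC CASE of the non-vanishing of cup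
products of Hecke translates on the congruence tower of compact ball quotients — Clozel, *Produits dans la
cohomologie holomorphe des variétés de Shimura* II, J. reine angew. Math. 444 (1993); Venkataramana,
*Cohomology of compact locally symmetric spaces*, Compositio Math. 125 (2001), Thm. 8 with its Remark (`n = 2`,
`k = k' = 1`: «in the holomorphic case, this is proved in [S1] and [C2]») — here PROVED from the pointwise
line-field argument on the ball (density of the rational points + `SU(2)`-isotropy), i.e. the argument of the
period-relation manuscript PerL v5 Prop. 4.3, whose abstract core is the tree theorem
`DenseSubgroup.exists_wedge_ne_zero_of_SU2`.

## References

* L. Clozel, *Produits dans la cohomologie holomorphe des variétés de Shimura. II*, J. reine angew. Math. 444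
  (1993), 1–15 (the theorem on products of Hecke translates of holomorphic forms on compact unitary quotients).
* T. N. Venkataramana, *Cohomology of compact locally symmetric spaces*, Compositio Math. 125 (2001), 221–253,
  Thm. 8 and Remark, p. 229.
* A. Borel, *Automorphic forms on `SL₂(ℝ)`* (1997), §5.13–5.14.
* G. Shimura, *Introduction to the arithmetic theory of automorphic functions* (1971), §7.2–7.3.
* C. Voisin, *Hodge Theory and Complex Algebraic Geometry I* (2002), §7.1.1 Prop. 7.5, Cor. 7.6.

## Provenance

Reproduction (Literature) for the Hodge-ladder cell pub-hodgecm2 (COR-CM, stage 2), seat b06 (gen 19), lane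
WEDGE-PROOF: the analytic core of the displayed input B01-H `HeckeWedge10` of junction B01 (`PerLFace_of_PerL`).
Every declaration is kernel-checked; no new records.
-/

noncomputable section

open Matrix MulAction Function Set Filter
open scoped Manifold Topology TensorProduct
open CategoryTheory

namespace Literature.AlgebraicGeometry.ShimuraVarieties

/-! ### On the ball: spans of translates and the dense-translate wedge -/

namespace BallForms

open Literature.Geometry.ComplexHyperbolic Literature.Geometry.ComplexHyperbolic.BallModel
open Literature.Topology.Algebra

/-- `wedge` is additive in the first slot. [folklore] -/
private theorem wedge_add_left (a a' b : Fin 2 → ℂ) : wedge (a + a') b = wedge a b + wedge a' b := by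
  simp only [wedge, Pi.add_apply]; ring

/-- `wedge` is homogeneous in the first slot. [folklore] -/
private theorem wedge_smul_left (c : ℂ) (a b : Fin 2 → ℂ) : wedge (c • a) b = c * wedge a b := by
  simp only [wedge, Pi.smul_apply, smul_eq_mul]; ring

/-- `wedge` is additive in the second slot. [folklore] -/
private theorem wedge_add_right (a b b' : Fin 2 → ℂ) : wedge a (b + b') = wedge a b + wedge a b' := by
  simp only [wedge, Pi.add_apply]; ring

/-- `wedge` is homogeneous in the second slot. [folklore] -/
private theorem wedge_smul_right (c : ℂ) (a b : Fin 2 → ℂ) : wedge a (c • b) = c * wedge a b := by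
  simp only [wedge, Pi.smul_apply, smul_eq_mul]; ring

/-- `wedge 0 b = 0`. [folklore] -/
private theorem wedge_zero_left (b : Fin 2 → ℂ) : wedge 0 b = 0 := by
  simp [wedge]

/-- `wedge a 0 = 0`. [folklore] -/
private theorem wedge_zero_right (a : Fin 2 → ℂ) : wedge a 0 = 0 := by
  simp [wedge]

/-- **The transpose-inverse Jacobian is the transposed Jacobian of the inverse**:
`((J(γ,z))ᵀ)⁻¹ = J(γ⁻¹, γ z)ᵀ` (both invert `J(γ,z)ᵀ`: `Jac_inv_mul`, `coT_mul_transpose_Jac`). [folklore]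
[cite: Borel1997, §5.13] -/
theorem coT_eq_transpose_Jac_inv (γ : U21) (z : Ball) : coT γ z = (Jac γ⁻¹ (γ • z))ᵀ := by
  have h1 : coT γ z * (Jac γ z)ᵀ = 1 := coT_mul_transpose_Jac γ z
  have h2 : (Jac γ z)ᵀ * (Jac γ⁻¹ (γ • z))ᵀ = 1 := by
    rw [← transpose_mul, Jac_inv_mul, transpose_one]
  calc coT γ z = coT γ z * ((Jac γ z)ᵀ * (Jac γ⁻¹ (γ • z))ᵀ) := by rw [h2, Matrix.mul_one]
    _ = (Jac γ⁻¹ (γ • z))ᵀ := by rw [← Matrix.mul_assoc, h1, Matrix.one_mul]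

/-- **The translate of a translate**: `δ^*(γ^* F) = (γδ)^* F`, i.e.
`J(δ,w)ᵀ · (J(γ, δw)ᵀ · F(γ δ w)) = J(γδ, w)ᵀ · F((γδ) w)` (the cocycle identity of the Jacobian).
[cite: Borel1997, §5.13] -/
theorem translate_translate (γ δ : U21) (F : Ball → (Fin 2 → ℂ)) (w : Ball) :
    (Jac δ w)ᵀ *ᵥ ((Jac γ (δ • w))ᵀ *ᵥ F (γ • (δ • w))) = (Jac (γ * δ) w)ᵀ *ᵥ F ((γ * δ) • w) := by
  rw [mulVec_mulVec, ← transpose_Jac_mul, mul_smul]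

/-- The translate by `1` is the section itself. [folklore] -/
private theorem translate_one (F : Ball → (Fin 2 → ℂ)) : (fun z ↦ (Jac 1 z)ᵀ *ᵥ F ((1 : U21) • z)) = F := by
  funext z
  rw [transpose_Jac_one, one_mulVec, one_smul]

/-- **The span of the `Δ`-translates of `F` is stable under translation by `Δ`**: for `γ ∈ Δ` and `u` in the
span, `γ^* u` is in the span (translation is linear, and `γ^*(δ^* F) = (δγ)^* F` with `δγ ∈ Δ`).
[cite: Borel1997, §5.13–5.14] -/
theorem translate_mem_span_translates (Δ : Subgroup U21) (F : Ball → (Fin 2 → ℂ)) {γ : U21} (hγ : γ ∈ Δ)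
    {u : Ball → (Fin 2 → ℂ)}
    (hu : u ∈ Submodule.span ℂ {v : Ball → (Fin 2 → ℂ) | ∃ δ ∈ Δ, v = fun z ↦ (Jac δ z)ᵀ *ᵥ F (δ • z)}) :
    (fun w ↦ (Jac γ w)ᵀ *ᵥ u (γ • w)) ∈
      Submodule.span ℂ {v : Ball → (Fin 2 → ℂ) | ∃ δ ∈ Δ, v = fun z ↦ (Jac δ z)ᵀ *ᵥ F (δ • z)} := by
  induction hu using Submodule.span_induction with
  | mem v hv =>
    obtain ⟨δ, hδ, rfl⟩ := hv
    refine Submodule.subset_span ⟨δ * γ, Δ.mul_mem hδ hγ, ?_⟩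
    funext w
    exact translate_translate δ γ F w
  | zero =>
    have h0 : (fun w ↦ (Jac γ w)ᵀ *ᵥ (0 : Ball → (Fin 2 → ℂ)) (γ • w)) = 0 := by
      funext w; simp
    rw [h0]; exact Submodule.zero_mem _
  | add v v' _ _ hv hv' =>
    have h : (fun w ↦ (Jac γ w)ᵀ *ᵥ (v + v') (γ • w)) =
        (fun w ↦ (Jac γ w)ᵀ *ᵥ v (γ • w)) + fun w ↦ (Jac γ w)ᵀ *ᵥ v' (γ • w) := by
      funext w; simp [mulVec_add]
    rw [h]; exact Submodule.add_mem _ hv hv'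
  | smul c v _ hv =>
    have h : (fun w ↦ (Jac γ w)ᵀ *ᵥ (c • v) (γ • w)) = c • fun w ↦ (Jac γ w)ᵀ *ᵥ v (γ • w) := by
      funext w; simp [mulVec_smul]
    rw [h]; exact Submodule.smul_mem _ c hv

/-- **The span of the `Δ`-translates is `Δ`-stable for the transpose-inverse Jacobian cocycle `A`** (in the sense of
`DenseSubgroup.StableUnder`): for `u` in the span, `u' := (γ⁻¹)^* u` satisfies `u'(γ x) = J(γ⁻¹, γx)ᵀ u(x) = A γ x (u x)`.
[cite: Borel1997, §5.13–5.14] -/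
theorem stableUnder_span_translates (Δ : Subgroup U21) (F : Ball → (Fin 2 → ℂ)) :
    DenseSubgroup.StableUnder Δ A
      (Submodule.span ℂ {v : Ball → (Fin 2 → ℂ) | ∃ δ ∈ Δ, v = fun z ↦ (Jac δ z)ᵀ *ᵥ F (δ • z)}) := by
  intro γ hγ u hu
  refine ⟨fun w ↦ (Jac γ⁻¹ w)ᵀ *ᵥ u (γ⁻¹ • w), translate_mem_span_translates Δ F (Δ.inv_mem hγ) hu, ?_⟩
  intro x
  change (Jac γ⁻¹ (γ • x))ᵀ *ᵥ u (γ⁻¹ • γ • x) = A γ x (u x)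
  rw [A_apply, inv_smul_smul, coT_eq_transpose_Jac_inv]

/-- The span of the `Δ`-translates of a holomorphic section consists of continuous sections (translates of
holomorphic sections are holomorphic, `translate_mem_holomorphic`). [cite: Borel1997, §5.13–5.14] -/
theorem continuous_of_mem_span_translates (Δ : Subgroup U21) {F : Ball → (Fin 2 → ℂ)}
    (hF : F ∈ holomorphic (Fin 2 → ℂ)) {u : Ball → (Fin 2 → ℂ)}
    (hu : u ∈ Submodule.span ℂ {v : Ball → (Fin 2 → ℂ) | ∃ δ ∈ Δ, v = fun z ↦ (Jac δ z)ᵀ *ᵥ F (δ • z)}) :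
    Continuous u := by
  have hle : Submodule.span ℂ {v : Ball → (Fin 2 → ℂ) | ∃ δ ∈ Δ, v = fun z ↦ (Jac δ z)ᵀ *ᵥ F (δ • z)} ≤
      holomorphic (Fin 2 → ℂ) := by
    rw [Submodule.span_le]
    rintro _ ⟨δ, -, rfl⟩
    exact translate_mem_holomorphic δ hF
  exact continuous_of_mem_holomorphic (hle hu)

/-- The span of the `Δ`-translates of a non-zero section is non-zero (`F = 1^* F` is a translate). [folklore] -/
private theorem span_translates_ne_bot (Δ : Subgroup U21) {F : Ball → (Fin 2 → ℂ)} (hF : F ≠ 0) :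
    Submodule.span ℂ {v : Ball → (Fin 2 → ℂ) | ∃ δ ∈ Δ, v = fun z ↦ (Jac δ z)ᵀ *ᵥ F (δ • z)} ≠ ⊥ := by
  rw [Submodule.ne_bot_iff]
  exact ⟨F, Submodule.subset_span ⟨1, Δ.one_mem, (translate_one F).symm⟩, hF⟩

/-- **If all translates `γ^* F`, `γ ∈ Δ`, have zero wedge with `G` everywhere, then all pairs of translates
`γ^* F`, `δ^* G` do** (move `δ` across: `γ^* F = δ^*((γδ⁻¹)^* F)`, `wedge (Mᵀ a) (Mᵀ b) = det M · wedge a b`).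
[cite: Borel1997, §5.13] -/
theorem wedge_translate_translate_eq_zero (Δ : Subgroup U21) {F G : Ball → (Fin 2 → ℂ)}
    (h : ∀ γ ∈ Δ, ∀ z : Ball, wedge ((Jac γ z)ᵀ *ᵥ F (γ • z)) (G z) = 0)
    {γ δ : U21} (hγ : γ ∈ Δ) (hδ : δ ∈ Δ) (z : Ball) :
    wedge ((Jac γ z)ᵀ *ᵥ F (γ • z)) ((Jac δ z)ᵀ *ᵥ G (δ • z)) = 0 := by
  have hγ' : γ = (γ * δ⁻¹) * δ := by group
  have hF : (Jac γ z)ᵀ *ᵥ F (γ • z) = (Jac δ z)ᵀ *ᵥ ((Jac (γ * δ⁻¹) (δ • z))ᵀ *ᵥ F ((γ * δ⁻¹) • (δ • z))) := by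
    conv_lhs => rw [hγ']
    rw [translate_translate]
  rw [hF, wedge_mulVec, h _ (Δ.mul_mem hγ (Δ.inv_mem hδ)) (δ • z), mul_zero]

/-- **Dense-translate wedge on the ball.**  For a dense subgroup `Δ ≤ U(2,1)` and non-zero holomorphic sections
`F, G : 𝔹² → ℂ²`, some translate `γ^* F`, `γ ∈ Δ`, has a non-zero wedge with `G` at some point:
`(J(γ,z)ᵀ F(γ z)) ∧ G(z) ≠ 0`.  Proof: otherwise every pair of translates `γ^*F`, `δ^*G` has identically zero
wedge (`wedge_translate_translate_eq_zero`), hence (bilinearity) so has every pair in the spans of translates — two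
non-zero `Δ`-stable spaces of continuous cotangent fields — contradicting the line-field theorem
`BallModel.exists_wedge_ne_zero'` (density of `Δ`, transitivity, `SU(2)`-isotropy at the origin).  This is the
pointwise core of the non-vanishing of products of Hecke translates of holomorphic one-forms (Clozel 1993;
Venkataramana 2001, Thm. 8, holomorphic case). [cite: Venkataramana2001, Thm. 8 and Remark, p. 229]
[cite: Clozel1993ProduitsII, Introduction (théorème principal)] -/
theorem exists_translate_wedge_ne_zero (Δ : Subgroup U21) (hΔ : Dense (Δ : Set U21))
    {F G : Ball → (Fin 2 → ℂ)} (hF : F ∈ holomorphic (Fin 2 → ℂ)) (hG : G ∈ holomorphic (Fin 2 → ℂ))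
    (hF0 : F ≠ 0) (hG0 : G ≠ 0) :
    ∃ γ ∈ Δ, ∃ z : Ball, wedge ((Jac γ z)ᵀ *ᵥ F (γ • z)) (G z) ≠ 0 := by
  by_contra hcon
  push Not at hcon
  -- all pairs of translates have zero wedge
  have hpair : ∀ γ ∈ Δ, ∀ δ ∈ Δ, ∀ z : Ball,
      wedge ((Jac γ z)ᵀ *ᵥ F (γ • z)) ((Jac δ z)ᵀ *ᵥ G (δ • z)) = 0 :=
    fun γ hγ δ hδ z ↦ wedge_translate_translate_eq_zero Δ hcon hγ hδ z
  -- the two spans of translates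
  set 𝒰₁ := Submodule.span ℂ {v : Ball → (Fin 2 → ℂ) | ∃ δ ∈ Δ, v = fun z ↦ (Jac δ z)ᵀ *ᵥ F (δ • z)} with h𝒰₁
  set 𝒰₂ := Submodule.span ℂ {v : Ball → (Fin 2 → ℂ) | ∃ δ ∈ Δ, v = fun z ↦ (Jac δ z)ᵀ *ᵥ G (δ • z)} with h𝒰₂
  -- every pair in the spans has zero wedge everywhere
  have hspan : ∀ u₁ ∈ 𝒰₁, ∀ u₂ ∈ 𝒰₂, ∀ x : Ball, wedge (u₁ x) (u₂ x) = 0 := by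
    intro u₁ hu₁ u₂ hu₂ x
    -- first: generators of `𝒰₁` against all of `𝒰₂`
    have hgen : ∀ v₁ ∈ {v : Ball → (Fin 2 → ℂ) | ∃ δ ∈ Δ, v = fun z ↦ (Jac δ z)ᵀ *ᵥ F (δ • z)},
        ∀ u ∈ 𝒰₂, wedge (v₁ x) (u x) = 0 := by
      rintro _ ⟨γ, hγ, rfl⟩ u hu
      induction hu using Submodule.span_induction with
      | mem v hv =>
        obtain ⟨δ, hδ, rfl⟩ := hv
        exact hpair γ hγ δ hδ x
      | zero => exact wedge_zero_right _
      | add v v' _ _ hv hv' => rw [Pi.add_apply, wedge_add_right, hv, hv', add_zero]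
      | smul c v _ hv => rw [Pi.smul_apply, wedge_smul_right, hv, mul_zero]
    induction hu₁ using Submodule.span_induction with
    | mem v hv => exact hgen v hv u₂ hu₂
    | zero => exact wedge_zero_left _
    | add v v' _ _ hv hv' => rw [Pi.add_apply, wedge_add_left, hv, hv', add_zero]
    | smul c v _ hv => rw [Pi.smul_apply, wedge_smul_left, hv, mul_zero]
  -- the line-field theorem
  obtain ⟨u₁, hu₁, u₂, hu₂, x, hx⟩ := BallModel.exists_wedge_ne_zero' Δ hΔ 𝒰₁ 𝒰₂
    (fun u hu ↦ continuous_of_mem_span_translates Δ hF hu) (fun u hu ↦ continuous_of_mem_span_translates Δ hG hu)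
    (stableUnder_span_translates Δ F) (stableUnder_span_translates Δ G)
    (span_translates_ne_bot Δ hF0) (span_translates_ne_bot Δ hG0)
  exact hx (hspan u₁ hu₁ u₂ hu₂ x)

end BallForms

/-! ### On a compact ball quotient surface: the cup product of Hecke translates -/

namespace UnitaryBallUniformisationDatum

open Literature.Geometry.ComplexHyperbolic
open Literature.Geometry.ComplexHyperbolic.BallModel (U21 Ball Jac wedge)
open Literature.AlgebraicGeometry.HodgeTheory
open Literature.AlgebraicGeometry.Motives (bettiCohomology)

variable {X : Motives.SchemeOver ℂ} (D : UnitaryBallUniformisationDatum 2 X)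

/-- **The Hecke wedge of a compact ball quotient surface.**  Let `X(ℂ) = Γ\𝔹²` (datum `D`, frame `𝔣`), let
`Δ ≤ U(2,1)` be dense, and let `a, a' ∈ F¹H¹(X) = H^{1,0}` be NON-ZERO classes.  Then there is `ĝ ∈ Δ` such that
for EVERY ball quotient `X'` over the same hermitian space (datum `D'`, frame matrix that of `𝔣`), every
`g ∈ U(H^{τ₁})` with `T⁻¹ g T = ĝ`, every Hecke translation `T : X' ⟶ X` over `v ↦ g v` and every level covering
`π : X' ⟶ X` over `v ↦ v` (both on the negative cone), the cup product `T^* a ∪ π^* a'` in `ℂ ⊗_ℚ H²(X'(ℂ); ℚ)` is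
NON-ZERO.  Proof: the lifts of `a`, `a'` to the ball are non-zero holomorphic sections (`classLift_ne_zero`), so
`BallForms.exists_translate_wedge_ne_zero` gives `ĝ ∈ Δ`, `z` with `(ĝ^* lift a)(z) ∧ (lift a')(z) ≠ 0`; the lifts
of `T^*a`, `π^*a'` on `X'` are `ĝ^*(lift a)` (`classLift_pull_mulVec`) and `lift a'` (`classLift_pull`), and
`T^*a ∪ π^*a' = 0` would make their wedge vanish identically (`wedge_classLift_eq_zero`).  The holomorphic case of
Clozel 1993 / Venkataramana 2001 Thm. 8 for the tower over `X`, granted the Hecke translations as morphisms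
(`UnitaryBallHeckeTranslation`, `UnitaryBallLevelCovering`). [cite: Venkataramana2001, Thm. 8 and Remark, p. 229]
[cite: Clozel1993ProduitsII, Introduction (théorème principal)] [cite: VoisinHodgeI2002, §7.1.1 Prop. 7.5 and Cor. 7.6] -/
theorem exists_mem_forall_cup_pull_ne_zero (hHD : exists_isReal_hodgeModel)
    (hI : hodgePQ_independent_of_hodgeModel) (𝔣 : D.SylvesterFrame) (Δ : Subgroup U21)
    (hΔ : Dense (Δ : Set U21)) {hX : Motives.IsSmoothProjective 2 X} {a a' : ℂ ⊗[ℚ] bettiCohomology X 1}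
    (ha : a ∈ (BettiUniverse.hodge hHD hX 1).F 1) (ha' : a' ∈ (BettiUniverse.hodge hHD hX 1).F 1)
    (ha0 : a ≠ 0) (ha0' : a' ≠ 0) :
    ∃ ĝ ∈ Δ, ∀ {X' : Motives.SchemeOver ℂ} (D' : UnitaryBallUniformisationDatum 2 X') (𝔣' : D'.SylvesterFrame),
      𝔣'.t = 𝔣.t → ∀ {g : GL (Fin 3) ℂ} (hg : g ∈ D.realPoints), D.frameIso 𝔣 ⟨g, hg⟩ = ĝ →
        ∀ (T π : X' ⟶ X),
          (∀ v ∈ D'.cone, Motives.AlgPoints.map T (D'.unif v) = D.unif ((g : Matrix (Fin 3) (Fin 3) ℂ) *ᵥ v)) →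
          (∀ v ∈ D'.cone, Motives.AlgPoints.map π (D'.unif v) = D.unif v) →
            LinearMap.BilinMap.baseChange ℂ (BettiUniverse.cup X' 1 1)
              ((BettiUniverse.pull T 1).baseChange ℂ a) ((BettiUniverse.pull π 1).baseChange ℂ a') ≠ 0 := by
  -- the non-zero holomorphic lifts and the dense-translate wedge on the ball
  obtain ⟨ĝ, hĝΔ, z, hz⟩ := BallForms.exists_translate_wedge_ne_zero Δ hΔ
    (D.classLift_mem_holomorphic hHD 𝔣 a) (D.classLift_mem_holomorphic hHD 𝔣 a')
    (D.classLift_ne_zero hHD 𝔣 hI ha ha0) (D.classLift_ne_zero hHD 𝔣 hI ha' ha0')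
  refine ⟨ĝ, hĝΔ, ?_⟩
  intro X' D' 𝔣' hT g hg hĝ T π hTu hπu hcup
  -- the pulled-back classes are in `F¹H¹(X')`
  have hTa : (BettiUniverse.pull T 1).baseChange ℂ a ∈ (BettiUniverse.hodge hHD D'.isSmoothProjective 1).F 1 :=
    BettiUniverse.pull_hodge hHD hI D'.isSmoothProjective hX T 1 1 ⟨a, ha, rfl⟩
  have hπa : (BettiUniverse.pull π 1).baseChange ℂ a' ∈ (BettiUniverse.hodge hHD D'.isSmoothProjective 1).F 1 :=
    BettiUniverse.pull_hodge hHD hI D'.isSmoothProjective hX π 1 1 ⟨a', ha', rfl⟩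
  -- zero cup ⇒ zero wedge of the lifts on `X'`, which are `ĝ^*(lift a)` and `lift a'`
  have hw := D'.wedge_classLift_eq_zero hHD 𝔣' hI hTa hπa hcup z
  rw [D.classLift_pull_mulVec hHD 𝔣 hI D' 𝔣' T hT hg hTu ha, D.classLift_pull hHD 𝔣 hI D' 𝔣' π hT hπu ha',
    hĝ] at hw
  exact hz hw

end UnitaryBallUniformisationDatum

end Literature.AlgebraicGeometry.ShimuraVarieties

end
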